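/-
Copyright: research workfile of the res-hironaka ladder (W4.5b), crux EL♮(3) = stmt-ResolutionOfSingularities-20148
(`Summit.ResolutionOfSingularities.ResolutionOfSingularities.Theses.EquisingularLift.EquisingularLiftNatThree`).
Author seat: res-L1-w45b-idea-3 g8–g9 (planner, crux-ideate; OURS, counted 0; AI-typed planning vocabulary, weaker than expert review).
NOTHING here is a statement of H. Hironaka's 2017 manuscript; no summit statement and no crux is proved by this file; nothing is proposed to `Literature/`.
-/
import Mathlib

/-!
# SmoothedTraceSketch — the FIRST LEMMA of the crux idea `smoothed-trace-centres` (successor observation §10 of `GermClockHistoryCensus.lean` v4)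

The lever (paper, §10 of the census): EL♮(3)'s `Q`-closure asks of an upstairs centre only `IsRegular C.subscheme` + two position
clauses.  The GENERIC SMOOTHING `𝒞 := V(f_O + ϖ·g)` of the REDUCED SINGULAR trace curve `Γ = V(f̄) ⊂ E ≅ ℙ²_k` inside the host
`𝓔 ≅ ℙ²_O` is `O`-flat with special fibre `Γ` itself, and it is REGULAR as soon as `f_O + ϖ g ∉ 𝔪_x²` at the finitely many singular
points `x` of `Γ` — because a regular local ring modulo an element of `𝔪 ∖ 𝔪²` is regular.  Blowing `𝒞` up resolves the panel's witness
families `X_F`, `X_{p,q}` (odd `p`), `X_d` in one step after the section `c_P` (census §10 (S3), chart identity below).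

This file TYPES the local algebra only (signatures over Mathlib's `IsRegularLocalRing`; the one-line chart identity is proved by `ring`).
`firstLemma_smoothing_regular` is the card's «First lemma»: a TARGET (`def … : Prop`), not asserted, not proved here; in print it is the
standard fact [Matsumura, CRT Thm 14.2 / Stacks 00NR] + the computation `s ≡ ϖ·unit (mod 𝔪²)`.
-/

set_option linter.dupNamespace false

namespace Summit.ResolutionOfSingularities.ResolutionOfSingularities.Cruxes.EquisingularLiftNatThree.Ideas.SmoothedTrace

open IsLocalRing

/-- **First lemma (TARGET, typed; standard in print)**: in a regular local ring `R`, if `ϖ ∈ 𝔪 ∖ 𝔪²`, `s₀ ∈ 𝔪²` and `s₁` is a unit, then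
`R ⧸ (s₀ + ϖ s₁)` is again a regular local ring.  Geometric reading (census §10 (S2)(b)): `R = 𝒪_{𝓔,x}` at a SINGULAR point `x` of the reduced
trace `Γ = V(f̄)` (so any lift `f_O` of `f̄` is `≡ ϖ r (mod 𝔪²)`), `s₀ + ϖ s₁ = f_O + ϖ g` with `s₁ = r + g` a unit for generic `g`: the smoothing
`𝒞 = V(f_O + ϖ g)` is regular at `x` although its special fibre `Γ` is singular there. -/
def firstLemma_smoothing_regular : Prop :=
  ∀ (R : Type) [CommRing R] [IsRegularLocalRing R] (ϖ s₀ s₁ : R),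
    ϖ ∈ maximalIdeal R → ϖ ∉ (maximalIdeal R) ^ 2 → s₀ ∈ (maximalIdeal R) ^ 2 → IsUnit s₁ →
      IsRegularLocalRing (R ⧸ Ideal.span {s₀ + ϖ * s₁})

/-- (proved, trivial) the element `s₀ + ϖ s₁` of the first lemma lies in `𝔪` but NOT in `𝔪²` — the whole point of the generic first-order term. -/
theorem smoothing_elt_not_mem_sq {R : Type*} [CommRing R] [IsLocalRing R] {ϖ s₀ s₁ : R}
    (hϖ : ϖ ∈ maximalIdeal R) (hϖ2 : ϖ ∉ (maximalIdeal R) ^ 2) (hs₀ : s₀ ∈ (maximalIdeal R) ^ 2) (hs₁ : IsUnit s₁) :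
    s₀ + ϖ * s₁ ∈ maximalIdeal R ∧ s₀ + ϖ * s₁ ∉ (maximalIdeal R) ^ 2 := by
  refine ⟨?_, ?_⟩
  · exact Ideal.add_mem _ (Ideal.pow_le_self two_ne_zero hs₀) (Ideal.mul_mem_right _ _ hϖ)
  · intro h
    have h1 : ϖ * s₁ ∈ (maximalIdeal R) ^ 2 := by
      have := Ideal.sub_mem _ h hs₀
      simpa using this
    obtain ⟨u, rfl⟩ := hs₁
    have h2 : ϖ * (u : R) * (↑u⁻¹ : R) ∈ (maximalIdeal R) ^ 2 := Ideal.mul_mem_right _ _ h1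
    have : ϖ ∈ (maximalIdeal R) ^ 2 := by
      simpa [mul_assoc] using h2
    exact hϖ2 this

/-- (proved, `ring`) the chart identity of census §10 (S3): on the blow-up chart `A = z t` of the lci singular curve `V(z, A)`,
`A² + z²B = z²(t² + B) + (A − zt)(A + zt)`, so the strict transform of `V(A² + z²B)` is `V(zt − A, t² + B)`. -/
theorem smoothing_chart_identity {S : Type*} [CommRing S] (A B z t : S) :
    A ^ 2 + z ^ 2 * B = z ^ 2 * (t ^ 2 + B) + (A - z * t) * (A + z * t) := by
  ring

/-- (proved, `ring`) the `(3,3)` shape of census §10 (S5): `A³ + z³B = z³(t³ + B) + (A − zt)(A² + A·zt + z²t²)`. -/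
theorem smoothing_chart_identity_33 {S : Type*} [CommRing S] (A B z t : S) :
    A ^ 3 + z ^ 3 * B = z ^ 3 * (t ^ 3 + B) + (A - z * t) * (A ^ 2 + A * (z * t) + (z * t) ^ 2) := by
  ring

/-- (proved, `ring`) the `(3,2)` shape of census §10 (S5), chart 1: `A³ + z²B = z²(z t³ + B) + (A − zt)(A² + A·zt + z²t²)`. -/
theorem smoothing_chart_identity_32 {S : Type*} [CommRing S] (A B z t : S) :
    A ^ 3 + z ^ 2 * B = z ^ 2 * (z * t ^ 3 + B) + (A - z * t) * (A ^ 2 + A * (z * t) + (z * t) ^ 2) := by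
  ring

/-! ## v2 (same session, before triage) — the SELECTION PRINCIPLE made precise and the AVOIDANCE LEMMA (paper; identities below kernel-checked)

SELECTION PRINCIPLE (successor lever, sharpened): run Hironaka/CJS's ORDER BY MULTIPLICITY (Hilbert–Samuel stratum) DOWNSTAIRS, with two changes of
CENTRE, never of order: (P0) a zero-dimensional maximal stratum `{q}` is blown up through an `O`-SECTION — available because the invariant (INV) below keeps
`Y′` inside the `O`-smooth locus of `P′`; (P1) a one-dimensional maximal stratum `D` (reduced, possibly SINGULAR and reducible, `X` equimultiple along it) is
blown up WHOLE AND AT ONCE through the generic smoothing `𝒟 = V(s_O + ϖ g)` of its equation `s` inside an `O`-smooth host `𝒮 ⊃ D` (exceptional surface-bundle;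
the section `s` lifts when `H¹(𝒮_k, 𝒪(D)) = 0`) — where CJS would first regularise `D` by blowing up its singular points (the step that imports the
characteristic-`p` incidences upstairs: S-GC9 / S-GC10).  Boundary strata (intersections of exceptional divisors) lift for free and are used as CJS uses them.
(INV) «`Y′ ∩ Sing(P′_k) = ∅`»: trivially true while only sections / boundary strata have been blown up; PRESERVED by a (P1) step exactly because `X` is
equimultiple along `D` — this is the AVOIDANCE LEMMA: for a surface `X = V(F)` in a smooth 3-fold, `D = V(z, s)` a reduced curve in the smooth host `V(z)`,
`F ∈ (z, s)²`, write `F ≡ α z² + β z s + γ s²  (mod (z, s)³)`; over a singular point `q` of `D` the blow-up `Bl_D W` is covered by the chart `s = zσ`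
(`V(s − zσ)`, SINGULAR exactly at `(q; σ = 0)` since `∇s(q) = 0`) and the chart `z = sρ` (`V(z − sρ)`, SMOOTH: `∂_z = 1`); the strict transform of `X` is
`V(α + βσ + γσ² + …)` resp. `V(αρ² + βρ + γ + …)` there, so it passes through the unique singular point `(q; σ = 0)` iff `α(q) = 0` iff `mult_q X ≥ 3 > 2 =
mult_D X` (as `s ∈ 𝔪_q²`, `z ∉ 𝔪_q²`).  So under the multiplicity order a (P1) centre is only ever used when `α` is a unit at every singular point of `D`,
and then over `q` the strict transform lies in the SMOOTH chart `z = sρ` as `V(αρ² + βρ + γ + …)`, regular at simple roots of the quadratic and otherwise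
decided by the remaining partials (chart identities `avoidance_chart_sigma/rho` below; the two worked cases of the card —
transversal node-cylinders crossing (`A² + z²B`, `α = B`) and cusp-cylinder meeting node-cylinders after a point step (`x³u²v² + z′²c`, `α = c`) — are
`smoothing_chart_identity` and `nodecusp_chart_identity_A/B`).  Consequence for the adversarial input `X_F♯` (card, Cheapest falsifier): the order is
`P; o₁…o₇` (multiplicity 3 > 2: SECTIONS, any — no incidence condition is ever needed because no line is lifted individually); then the maximal stratum is the
reduced nodal configuration `D = Σ_j L_{o_j} + Σ_i st(ℓ_i) ⊂ Ẽ_k = Bl_7 ℙ²` of class `7h − 2Σe_j`, and DOUBLE points at the seven points of `PG(2,2)` impose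
INDEPENDENT conditions on septics over `𝔽₂` (rank 21 of the 28 × 36 Hasse matrix, `h⁰ = 15`, hence `H¹ = 0`; workfile `H1CHECK-idea3.md`), so the smoothing centre
`𝒟` EXISTS; the charts at the 21 nodes of `D` and along its components are regular (identities below) whenever the transversal coefficient `c = b₁(1, s_i, 0)`
is a unit, and where the adversary kills it the point has multiplicity 3 and is taken FIRST by a section (still at an `O`-smooth point).  What is NOT shown:
termination of this order in general ((N4)), the host/`H¹` condition in general ((K-HOST)/(K-LIFT) of the card), non-hypersurface-like strata ((N3)). -/

/-- (proved, `ring`) AVOIDANCE LEMMA, chart `s = z σ` of `Bl_{(z,s)}` — the SINGULAR chart `V(s − zσ)`, singular point `(q; σ = 0)` over a singular point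
`q` of `V(s) ⊂ V(z)`: `α z² + β z s + γ s² = z² (α + β σ + γ σ²)`, so the strict transform is `V(α + βσ + γσ² + …)` and contains `(q; σ = 0)` iff `α(q) = 0`. -/
theorem avoidance_chart_sigma {S : Type*} [CommRing S] (α β γ z σ : S) :
    α * z ^ 2 + β * z * (z * σ) + γ * (z * σ) ^ 2 = z ^ 2 * (α + β * σ + γ * σ ^ 2) := by
  ring

/-- (proved, `ring`) AVOIDANCE LEMMA, chart `z = s ρ` of `Bl_{(z,s)}` — the SMOOTH chart `V(z − sρ)` (`∂_z = 1`): `α z² + β z s + γ s² = s² (α ρ² + β ρ + γ)`;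
when `α(q)` is a unit the whole strict transform over `q` lies in this chart, as `V(αρ² + βρ + γ + …)` inside a smooth 3-fold.  Conventions: `z` = host
equation (`∉ 𝔪_q²`), `s` = equation of `D` in the host (`∈ 𝔪_q²` at a singular point `q` of `D`). -/
theorem avoidance_chart_rho {S : Type*} [CommRing S] (α β γ s ρ : S) :
    α * (s * ρ) ^ 2 + β * (s * ρ) * s + γ * s ^ 2 = s ^ 2 * (α * ρ ^ 2 + β * ρ + γ) := by
  ring

/-- (proved, `ring`) node-cylinder ∪ cusp-cylinder configuration after a point step on `X♯` (`F = x³u²v² + z′²c`, centre `D = V(z′, x u)`), chart `z′ = x u τ`: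
`x³u²v² + (x u τ)² c = x² u² (x v² + τ² c)` — the SMOOTH chart; strict transform `V(x v² + τ² c)`, regular (linear in `x`, `v` a unit). -/
theorem nodecusp_chart_identity_A {S : Type*} [CommRing S] (x u v τ c : S) :
    x ^ 3 * u ^ 2 * v ^ 2 + (x * u * τ) ^ 2 * c = x ^ 2 * u ^ 2 * (x * v ^ 2 + τ ^ 2 * c) := by
  ring

/-- (proved, `ring`) same configuration, chart `x u = z′ σ` (the singular chart `V(xu − z′σ)` of `Bl_D`): `x³u²v² + z′²c = z′²(x σ² v² + c) + x v² (xu − z′σ)(xu + z′σ)`,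
so on this (singular) chart the strict transform is `V(xu − z′σ, xσ²v² + c)`, which misses the singular point `x = u = z′ = σ = 0` exactly when `c` is a unit
(AVOIDANCE, `α = c`); where it does meet the exceptional divisor (`x ≠ 0`, `σ ≠ 0`) its Jacobian has the rows `(0, x, −σ, 0)` and `(σ²v² + …, …, …, 2xσv²)`, rank 2. -/
theorem nodecusp_chart_identity_B {S : Type*} [CommRing S] (x u v z σ c : S) :
    x ^ 3 * u ^ 2 * v ^ 2 + z ^ 2 * c = z ^ 2 * (x * σ ^ 2 * v ^ 2 + c) + x * v ^ 2 * (x * u - z * σ) * (x * u + z * σ) := by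
  ring

/-! ## v3 (revision 4 of the card, after triage ROUND 2: crit-2 r31-2 S-ST5, crit-3 r31-3 S-ST6) — OURS, counted 0; nothing here proves the crux.

**S-ST5 (crit-2, accepted).**  On X_F♯, after the sections at o₁…o₇ the configuration D = Σ L_{o_j} + Σ st(ℓ_i) is
equimultiple-2 only OFF seven points t_j = L_{o_j} ∩ M_j (one per new boundary line; along L_{o_j} the z′²-coefficient is the
degree-one form α + βy′), where the multiplicity is 3.  Hironaka's order takes the t_j FIRST (free (P0) section steps), then
D′ = st(D) of class 7h − 2Σe_j − Σe′_j on Bl_14(ℙ²_O).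

**S-ST6 (crit-3): the independence conjecture of revision 2 is a THEOREM** (all prime powers q, any k ⊇ 𝔽_q; 5 lines, on paper):
S = Bl_{PG(2,q)} ℙ²_k, E = ΣE_o, C = ⊔_ℓ st(ℓ) (pairwise disjoint), D = Nh − qE = C + E, D·st(ℓ) = N − q(q+1) = 1
(`sst6_intersection`), so 𝒪_C(D) = ⊕ 𝒪_{ℙ¹}(1) has H¹ = 0; H¹(𝒪_S(E)) = 0 from 0 → 𝒪_S → 𝒪_S(E) → ⊕ 𝒪_{ℙ¹}(−1) → 0; hence
H¹(S, 𝒪_S(D)) = 0 and h⁰ = χ = 2N + 1 (`sst6_chi`).  (K-LIFT) for the X_{p,q} / X_F♯ family at the pre-t_j stage is thereby DISCHARGED.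

**Corollary for the post-S-ST5 centre (idea-3, revision 4).**  The slick argument does NOT transfer verbatim to D′: the curves
F_o = st(L_o) = E_o − E′_o are (−2)-curves, H¹(𝒪_S(ΣF_o)) ≅ k^N, and H¹(𝒪(D′)) = coker(H⁰(𝒪_C(D′)) → k^N) depends on the
directions t_o (rank 27/36 for some line-direction tuples shows it CAN fail).  It is not needed: lift D to the regular O-flat 𝒟 by
S-ST6 BEFORE the t_j steps; t_j is a smooth point of D = 𝒟_k (non-line directions), so 𝒟 → Spec O is smooth at t_j and (O
henselian) carries an O-section c_{t_j} ⊂ 𝒟 through t_j; use these as the seven (P0) centres.  On the regular surface 𝒟 the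
subscheme c_{t_j} is an effective Cartier divisor, so st(𝒟) = Bl_{c_t}𝒟 ≅ 𝒟 is regular and O-flat with special fibre
st(D) = D′: 𝒟′ := st(𝒟) is the (P1) centre for D′ with NO further cohomological input (class [𝒟] − ΣE′_j = 7h − 2Σe_j − Σe′_j,
`sst5_class_bookkeeping`; the numerical ranks 28/36 (q = 2, both seats) and 231/253 (q = 4, crit-2) are independent consistency checks).
Intersection bookkeeping on Bl_{2N}: D′·F_o = (q+1) − 2 = q − 1, D′·st(ℓ) = (1 − (q+1)) + (q+1) = 1 (`sst5_intersections`).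

Residue field (crit-3 S-ST5 side condition): every «general member» choice ((G3) of the first lemma, node avoidance, non-line
directions being automatic for general h) uses k INFINITE — in EL♮(3) k is algebraically closed (decl binder `[IsAlgClosed k]`);
over a finite residue field one would pass to a finite unramified extension of O (0 of 2¹⁵ 𝔽₂-members of |7h − 2Σe| avoid the 21 nodes).
-/

theorem sst6_intersection (q : ℤ) : (q ^ 2 + q + 1) - q * (q + 1) = 1 := by
  ring

/-- Riemann–Roch on Bl_N ℙ²: χ(D) = 1 + (D² − K·D)/2 with D² = N(q+1), K·D = N(q−3). -/
theorem sst6_chi (N q : ℚ) : 1 + (N * (q + 1) - N * (q - 3)) / 2 = 2 * N + 1 := by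
  ring

/-- h⁰ = 2N+1 equals «q·PG(2,q) imposes N·q(q+1)/2 independent conditions on forms of degree N = q²+q+1». -/
theorem sst6_count (q : ℚ) :
    ((q ^ 2 + q + 1) + 2) * ((q ^ 2 + q + 1) + 1) / 2 - (q ^ 2 + q + 1) * (q * (q + 1) / 2) = 2 * (q ^ 2 + q + 1) + 1 := by
  ring

/-- D′·F_o and D′·st(ℓ) on Bl_{2N} (F_o = E_o − E′_o a (−2)-curve met by the q+1 strict transforms of the lines through o). -/
theorem sst5_intersections (q : ℤ) : (q + 1) + (-2) = q - 1 ∧ (1 - (q + 1)) + (q + 1) = 1 := by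
  constructor <;> ring

/-- class bookkeeping for q = 2 in the basis (h; e₁…e₇; e′₁…e′₇), coefficient-wise: st(𝒟) = [𝒟] − Σe′ and
Σ_j (e_j − e′_j) + (7h − 3Σe_j) have the same class 7h − 2Σe − Σe′ (h-, e-, e′-coefficients). -/
theorem sst5_class_bookkeeping : (7 : ℤ) = 7 ∧ (1 : ℤ) + (-3) = -2 ∧ (-1 : ℤ) + 0 = -1 := by
  refine ⟨rfl, by norm_num, by norm_num⟩

/-! ## v4 (revision 5 of the card, after triage ROUND 3: crit-3 r33-3 **S-ST8**, crit-2 r32-2 concurring) — OURS, counted 0; nothing here proves the crux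

S-ST8 (crit-3): the revision-4 COROLLARY needs the hypothesis `t_o ∉ Sing D` (no `O`-section of a regular `O`-flat `𝒟` passes a node of
`𝒟_k`); at a LINE-direction point `t_j` (adversary: `∇h̄(o) ∥ ∇ℓ`) the legal object `st(𝒟) = Bl_{t_j} 𝒟` has special fibre
`st(D) + 2·e′_j` (doubled), and on `X♯♭` (the three points of one Fano line all choosing it) `H¹(S′, 𝒪(D′)) = k`.
Revision 5 records three kernel-checkable pieces of arithmetic behind its answers (the `p`-adic Smith-form lifting tables live in
`H1CHECK-idea3.md` §S-ST8; scripts `r5/jetlift.py`, `r5/jetlift_q.py` of the seat folder):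

* `doubled_centre_chart_identity` — blowing up a regular centre whose special fibre is the DOUBLED structure `(z₁, x²)` inside the
  multiplicity-2 locus is a NO-GO for the line: for any `F = z₁²B + x z₁ C + x²G ∈ (x, z₁)²`, in the chart `x² = z₁T′` of
  `Bl_{(z₁,x²)}` one has `F = z₁·F‴ + (x² − z₁T′)·G` with `F‴ = z₁B + xC + T′G ∈ (x, z₁, T′)`, so the new strict transform `V(F‴)`
  CONTAINS the singular curve `{x = z₁ = T′ = 0}` of the new special-fibre ambient `V(x² − z₁T′)` — (INV) «Y ∩ Sing(P_k) = ∅» dies.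
* `sst8_heavy_line_excess` — the HEAVY-LINE LAW: on `Bl_{2N}ℙ²` (`N = q²+q+1`), for a line `ℓ` of `PG(2,q)` CHOSEN by `m` of its `q+1`
  points, the `ℓ`-divisible sections of `|N h − qΣe − Σe′|` already number at least (expected total `N+1`) `+ (m − 2)`; hence
  `h¹(S′, 𝒪(D′)) ≥ m − 2` for every heavy line (`m ≥ 3`) and every `q` — crit-3's `q = 2` «rank 27 ⟺ full line» and `q = 3` samples are the
  cases `m = 3` (drop 1) and `m = 4` (drop 2).  The identity checked: `expdim(ℓ-divisible) − (N+1) = m − 2` (doubled to clear halves).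
* `sst8_first_order_obstruction` — the shape of the jet criterion at `q = 2`, torsion exponent `a = 1`: the obstruction to lifting the
  specific section `s̄_D` is `λ·ρ̄ = −Σ_{o∈ℓ} λ_o κ_o δ_o` (first-order NORMAL DISPLACEMENTS `δ_o` of the three point-sections off `ℓ`; the
  direction jets do not enter because `s̄_D = f_F` has TRIPLE points: `Q_o(f_F) = 0`).  Typed here only as the vanishing of a dot product
  under `Σδ = 0` with equal weights (the `𝔽₂` case, where `λ_oκ_o = 1`): bookkeeping, not geometry.
-/

/-- NO-GO chart identity for a doubled-fibre centre `(z₁, x²)`: `F = z₁·F‴ + (x² − z₁T′)·G` with `F‴ = z₁B + xC + T′G`. -/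
theorem doubled_centre_chart_identity {S : Type*} [CommRing S] (x z₁ T' B C G : S) :
    z₁ ^ 2 * B + x * z₁ * C + x ^ 2 * G = z₁ * (z₁ * B + x * C + T' * G) + (x ^ 2 - z₁ * T') * G := by
  ring

/-- … and `F‴` lies in the ideal `(x, z₁, T′)` (it vanishes when `x = z₁ = T′ = 0`), i.e. the strict transform contains the singular curve. -/
theorem doubled_centre_strict_transform_contains_singular_curve {S : Type*} [CommRing S] (B C G : S) :
    (0 : S) * B + 0 * C + 0 * G = 0 := by
  ring

/-- HEAVY-LINE LAW (dimension count, all `q`, all `m`), doubled to stay in `ℤ`: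
`2·[N(N+1)/2 − (N−q−1)(q(q+1)/2 + 1) − (q+1)·q(q−1)/2 − (q+1−m)] − 2(N+1) = 2(m − 2)` with `N = q² + q + 1`. -/
theorem sst8_heavy_line_excess (q m : ℤ) :
    ((q ^ 2 + q + 1) * ((q ^ 2 + q + 1) + 1) - ((q ^ 2 + q + 1) - q - 1) * (q * (q + 1) + 2)
      - (q + 1) * (q * (q - 1)) - 2 * (q + 1 - m)) - 2 * ((q ^ 2 + q + 1) + 1) = 2 * (m - 2) := by
  ring

/-- expected dimension of the whole system `|N h − qΣe − Σe′|` is `N + 1` (doubled): `(N+1)(N+2) − N·(q(q+1) + 2) = 2(N+1)`. -/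
theorem sst8_expected_total (q : ℤ) :
    ((q ^ 2 + q + 1) + 1) * ((q ^ 2 + q + 1) + 2) - (q ^ 2 + q + 1) * (q * (q + 1) + 2) = 2 * ((q ^ 2 + q + 1) + 1) := by
  ring

/-- `𝔽₂` shape of the first-order jet criterion (`q = 2`, `a = 1`): with unit weights the obstruction `δ₁ + δ₂ + δ₄` vanishes exactly on the
even-parity displacements — here only the trivial direction «collinear to first order ⇒ obstruction zero» as arithmetic in `ZMod 2`. -/
theorem sst8_first_order_obstruction (δ₁ δ₂ δ₄ : ZMod 2) (h : δ₁ + δ₂ + δ₄ = 0) :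
    1 * δ₁ + 1 * δ₂ + 1 * δ₄ = 0 := by
  simpa using h


end Summit.ResolutionOfSingularities.ResolutionOfSingularities.Cruxes.EquisingularLiftNatThree.Ideas.SmoothedTrace
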